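import Literature.NumberTheory.EllipticCurves.Sprung2012.SharpFlatColemanKatoZetaJoint
import Literature.NumberTheory.EllipticCurves.Sprung2012.SharpFlatSelmerModuleFiniteProofs
import Literature.NumberTheory.EllipticCurves.Kobayashi2003.SignedSelmerTorsionOfColemanKatoProofs
import HarnessLib

/-!
# Sprung 2012, Thm. 1.2 / 7.14 (`X^•(E/ℚ_∞)` is finitely generated `Λ`-torsion when `L^• ≠ 0`) DERIVED
# in the kernel from the ♯/♭ Coleman–Kato package (Def. 6.1, Props. 7.3/7.6, Thm. 7.14 (3)), Kato's
# (12.2.2) (`𝐇¹_Γ ≠ 0`) and Kato's Thm. 12.4 (1) ∘ (17.13.1) (`X₀` torsion) — proofs only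

`Proofs` file (theorems only; no definition, no named fact, no instance, no notation) in the cluster
`Sprung2012`, the ♯/♭ twin — word for word — of
`Kobayashi2003/SignedSelmerTorsionOfColemanKatoProofs.lean` (`a_p = 0`, signs `±`). Seat: width seat
`cruxlead-stmt-BirchSwinnertonDyer-19875-w3` (gen 2) of the crux line `chromatic-common-zeros` for item
stmt-BirchSwinnertonDyer-19875 (`SprungLowerDivisibilityAtThree`, routes `SignedLowerHalves` / `PrintX8VS`);
the file slims that line's stub S5 `stub_heldInputs`, whose conjunct (i) is the named fact derived here
and whose conjunct (iii) is the package it is derived from. HONEST FRAMING: an IMPLICATION BETWEEN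
NAMED FACTS; none of the inputs is discharged; nothing is booked; no census cell moves; BSD / the crux
K1 are not proved by any of this.

## What is proved, and why

The named fact `Sprung2012.thm714_sharpFlatSelmerDual_finite_torsion` (F. Sprung, J. Number Theory 132
(2012), Thm. 1.2 p. 1486 = Thm. 7.14 p. 1504: for `E/ℚ`, an odd prime `p` of good supersingular
reduction — ANY `a_p` with `p ∣ a_p`, in particular `(3, ±3)` — and the colour `•` with `L^•_p ≠ 0`,
the Pontryagin dual `X^•(E/ℚ_∞)` of `Sel^•(E/ℚ_∞)` is a finitely generated torsion `Λ`-module) is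
route item stmt-BirchSwinnertonDyer-20414 `InputSharpFlatTorsion` of `PrintX8VS`, conjunct (4) of its
`PublishedInputsX8`, and conjunct (i) of S5 on the crux line above. Sprung PROVES it (proof of Thm. 7.14,
p. 1504) from the four-term sequence (3) `0 → 𝐇¹(T) → H¹_Iw(T)/ker ε₁Col^• ≅ Λ → X^•(E/K_∞) →
X⁰(E/K_∞) → 0`, whose first arrow is injective because `𝐇¹(T)` is free of rank one (Kato Thm. 12.4 (2);
Kobayashi Thm. 5.1 iii)) and `ε₁Col^•(z) = L^•_p ≠ 0` (Def. 6.1), together with the torsion of `X⁰`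
(Kato Thm. 12.4 (1); Kobayashi Cor. 7.2). The tree holds each input as a separate named fact on PINNED
objects:
* `Sprung2012.thm714seq_sharpFlatColemanKato_zeta` (this directory; route item 20772
  `InputSharpFlatColemanKatoZeta`): the structure `SharpFlatColemanKatoData … • I` — `colMap : 𝐇¹ → Λ`
  INJECTIVE when `L^• ≠ 0`, and for every dual datum `D` of `Sel^•(E/ℚ_∞)` and `Y` of
  `Sel₀(ℚ_∞, E[p^∞])` some `Λ → D.X → Y.X → 0` making `𝐇¹ →ᶜᵒˡ Λ → X^• → X₀ → 0` exact; its two-colour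
  reading `thm714seq_sharpFlatColemanKato_zetaJoint` (`SharpFlatColemanKatoZetaJoint.lean`) implies it
  (`thm714seq_sharpFlatColemanKato_zeta_of_joint`);
* `Kato2004.one_le_rank_iwasawaH1` (Kato (12.2.2), p. 220): `𝐇¹_Γ(T_pW) ≠ 0`;
* `Kato2004_fineSelmerDual_isTorsion` (Kato Thm. 12.4 (1) ∘ (17.13.1)): `X₀(E/ℚ_∞)` is `Λ`-torsion.
THIS FILE composes them: §1 the package form (module algebra `Kobayashi2003.isTorsion_of_exact_of_
injective_of_ne_zero` along `𝐇¹ →ᶜᵒˡ Λ → D.X → Y.X`); §2 **`thm714_sharpFlatSelmerDual_finite_torsion_of_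
colemanKato`**: the named fact Thm. 7.14 follows from the three facts above (finite generation is the
tree THEOREM `SharpFlatSelmerDualData.moduleFinite`; the period ratio `ϖ` of the package frame comes from
`ModularParametrizationData.exists_rat_mul_realPeriodRat_eq_plusPeriod`; the binder telescopes of the
fact and of the package coincide, so no generator change is needed); §3 the same from the joint package;
§4 a variant WITHOUT (12.2.2) when `ρ̄_{E,p}` is irreducible and a Néron-normalised `G₁ ≠ 0` exists
(`image_zeta_localized` at the height-one prime `(T)` puts a non-zero multiple of `G₁` in `colMap(Z)`,
so `Z ≠ 0` and `𝐇¹ ≠ 0`) — the shape met on class X8 (`p = 3`, `E[3]` irreducible, `|ϖ|₃ = 1`).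

So every consumer of Thm. 7.14 may cite instead the package + two statements of Kato's §12 (or, at
irreducible image with a normalised generator, the package + Kato's Thm. 12.4 (1) alone) — Sprung's own
proof structure, kernel-checked. Nothing here is stronger than print.

References: [Sprung2012] F. Sprung, *Iwasawa theory for elliptic curves at supersingular primes: A pair
of main conjectures*, J. Number Theory 132 (2012), Thm. 1.2 (p. 1486), Def. 6.1 (p. 1495), Props.
7.3/7.6 (pp. 1500–1501), Def. 7.12 (p. 1503), Thm. 7.14 with (3) (p. 1504), Prop. 7.19 (p. 1505);
[Kato2004Asterisque] K. Kato, Astérisque 295 (2004), §12.2 (12.2.2) (p. 220), Thm. 12.4 (p. 221),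
Thm. 12.6 (p. 222), (17.13.1) (p. 279); [Kobayashi2003] S. Kobayashi, Invent. Math. 152 (2003),
Thm. 5.1, Cor. 7.2, Thm. 7.3, (7.21) (pp. 9–13); [GreenbergLNM1716] §1 p. 60.
-/

noncomputable section

open scoped Classical MatrixGroups ModularForm NumberField

open CongruenceSubgroup WeierstrassCurve Field NumberField IsDedekindDomain
  Literature.NumberTheory.EllipticCurves Literature.NumberTheory.EllipticCurves.ModularForms
  Literature.NumberTheory.GaloisRepresentations ZpExtension
  Literature.NumberTheory.EllipticCurves.Sprung2017

namespace Literature.NumberTheory.EllipticCurves.Sprung2012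

/-! ## §1 The package form: `X^•(E/ℚ_∞)` is torsion once `𝐇¹_Γ ≠ 0`, `L^• ≠ 0` and `X₀` is torsion -/

section Package

variable {W : WeierstrassCurve ℚ} [W.IsElliptic] {p : ℕ} [Fact p.Prime]
  [ContinuousSMul ℤ_[p] (W.tateModule p)] [Module.Free ℤ_[p] (W.tateModule p)]
  [Module.Finite ℤ_[p] (W.tateModule p)] {N : ℕ} {f : CuspForm (Gamma0 N) 2} {ϖ : ℚ}
  {κ : ZpExtension ℚ p} {γ : absoluteGaloisGroup ℚ}
  {E : Type} [Field E] [Algebra ℚ E] {ι : AlgebraicClosure ℚ →ₐ[ℚ] AlgebraicClosure E} {ap : ℤ}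
  {g : absoluteGaloisGroup E} {c : ℕ → localPoints W E} {col : Chroma}
  {I : Kato2004.IwasawaH1Data W p κ γ}

/-- **Sprung Thm. 7.14 (torsion clause) from the colour-`•` Coleman–Kato package**: given
`C : SharpFlatColemanKatoData W p f ϖ κ γ ι ap g c • I` (the sequence (3) for every dual datum, `colMap`
injective for a Sprung pair with `L^• ≠ 0`), if `𝐇¹_Γ(T_pW) ≠ 0` and some dual fine Selmer datum `Y`
has `X₀ = Y.X` torsion, then EVERY dual datum `D` of `Sel^•(E/ℚ_∞)` has `D.X` torsion — the module
algebra of `Kobayashi2003.isTorsion_of_exact_of_injective_of_ne_zero` along `𝐇¹ →ᶜᵒˡ Λ → D.X → Y.X`.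
[cite: Sprung2012, Thm. 7.14 with (3) (p. 1504)] -/
theorem SharpFlatColemanKatoData.isTorsion_of_nontrivial
    (C : SharpFlatColemanKatoData W p f ϖ κ γ ι ap g c col I) [Nontrivial I.H]
    {Lsharp Lflat : IwasawaAlgebra p} (hL : IsSprungPair f p ap Lsharp Lflat)
    (hL0 : chromaticL col Lsharp Lflat ≠ 0) (Y : W.FineSelmerDualData κ γ)
    (hY : Module.IsTorsion (IwasawaAlgebra p) Y.X) (D : SharpFlatSelmerDualData W κ γ ι ap g c col) :
    Module.IsTorsion (IwasawaAlgebra p) D.X := by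
  obtain ⟨e, he⟩ := exists_ne (0 : I.H)
  obtain ⟨j, k, hcj, hjk, -⟩ := C.exact D Y
  exact Kobayashi2003.isTorsion_of_exact_of_injective_of_ne_zero C.colMap j k
    (C.colMap_injective Lsharp Lflat hL hL0) hcj hjk he hY

/-- **Both colours at once**: from a ♯-package `Cs` and a ♭-package `Cf` on the same pinned `I` (the
output shape of `thm714seq_sharpFlatColemanKato_zetaJoint`), `𝐇¹ ≠ 0`, a torsion fine dual datum and a
Sprung pair with `L^• ≠ 0`: every dual datum of colour `•` is torsion (case split on `•`).
[cite: Sprung2012, Thm. 7.14 with (3) (p. 1504), Prop. 7.19 (p. 1505)] -/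
theorem SharpFlatColemanKatoData.isTorsion_of_nontrivial_of_pair
    (Cs : SharpFlatColemanKatoData W p f ϖ κ γ ι ap g c Chroma.sharp I)
    (Cf : SharpFlatColemanKatoData W p f ϖ κ γ ι ap g c Chroma.flat I) [Nontrivial I.H]
    {Lsharp Lflat : IwasawaAlgebra p} (hL : IsSprungPair f p ap Lsharp Lflat)
    (hL0 : chromaticL col Lsharp Lflat ≠ 0) (Y : W.FineSelmerDualData κ γ)
    (hY : Module.IsTorsion (IwasawaAlgebra p) Y.X) (D : SharpFlatSelmerDualData W κ γ ι ap g c col) :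
    Module.IsTorsion (IwasawaAlgebra p) D.X := by
  cases col with
  | sharp => exact Cs.isTorsion_of_nontrivial hL hL0 Y hY D
  | flat => exact Cf.isTorsion_of_nontrivial hL hL0 Y hY D

/-- **`𝐇¹_Γ ≠ 0` WITHOUT (12.2.2), at irreducible image**: if `ρ̄_{E,p}` is irreducible and a
Néron-normalised generator `G₁ ≠ 0` of colour `•` exists (`ι G₁ = C(ϖ)·ι L^•`), then the package's
`image_zeta_localized` at the height-one prime `(T)` gives `s ∉ (T)` with `s·G₁ ∈ colMap(Z)`; as
`s·G₁ ≠ 0` in the domain `Λ`, the zeta submodule `Z ⊂ 𝐇¹` has a non-zero element, so `𝐇¹ ≠ 0`.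
(Def. 6.1 + Kato Thm. 12.6: `Col^•(z_Kato) = L^•_p ≠ 0`.)
[cite: Sprung2012, Def. 6.1 (p. 1495), Def. 7.12 (p. 1503), Thm. 7.14 (p. 1504)] -/
theorem SharpFlatColemanKatoData.nontrivial_of_normalised
    (C : SharpFlatColemanKatoData W p f ϖ κ γ ι ap g c col I) (hirr : W.HasIrreducibleModPGaloisRep p)
    {Lsharp Lflat G₁ : IwasawaAlgebra p} (hL : IsSprungPair f p ap Lsharp Lflat)
    (hG₁ : iwasawaToPowerSeries p G₁ =
      PowerSeries.C ((ϖ : ℚ) : ℚ_[p]) * iwasawaToPowerSeries p (chromaticL col Lsharp Lflat))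
    (hG0 : G₁ ≠ 0) : Nontrivial I.H := by
  obtain ⟨s, hs, hsG, -⟩ := C.image_zeta_localized hirr Lsharp Lflat G₁ hL hG₁
    (IwasawaAlgebra.primeT p) (IwasawaAlgebra.height_primeT p)
  obtain ⟨z, -, hz⟩ := Submodule.mem_map.mp hsG
  have hs0 : s ≠ 0 := fun h ↦ hs (h ▸ Ideal.zero_mem _)
  have hz0 : z ≠ 0 := by
    rintro rfl
    rw [map_zero] at hz
    exact mul_ne_zero hs0 hG0 hz.symm
  exact nontrivial_of_ne z 0 hz0

/-- **Sprung Thm. 7.14 (torsion clause) WITHOUT (12.2.2), at irreducible image**: package `C` of colour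
`•`, `ρ̄_{E,p}` irreducible, a Sprung pair with `L^• ≠ 0` and a Néron-normalised `G₁ ≠ 0`, a torsion
fine dual datum `Y` ⟹ every dual datum of `Sel^•(E/ℚ_∞)` is `Λ`-torsion. (The shape met on class X8:
`p = 3`, `E[3]` irreducible, `|ϖ|₃ = 1`.)
[cite: Sprung2012, Def. 6.1 (p. 1495), Thm. 7.14 with (3) (p. 1504)] -/
theorem SharpFlatColemanKatoData.isTorsion_of_normalised
    (C : SharpFlatColemanKatoData W p f ϖ κ γ ι ap g c col I) (hirr : W.HasIrreducibleModPGaloisRep p)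
    {Lsharp Lflat G₁ : IwasawaAlgebra p} (hL : IsSprungPair f p ap Lsharp Lflat)
    (hL0 : chromaticL col Lsharp Lflat ≠ 0)
    (hG₁ : iwasawaToPowerSeries p G₁ =
      PowerSeries.C ((ϖ : ℚ) : ℚ_[p]) * iwasawaToPowerSeries p (chromaticL col Lsharp Lflat))
    (hG0 : G₁ ≠ 0) (Y : W.FineSelmerDualData κ γ) (hY : Module.IsTorsion (IwasawaAlgebra p) Y.X)
    (D : SharpFlatSelmerDualData W κ γ ι ap g c col) :
    Module.IsTorsion (IwasawaAlgebra p) D.X := by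
  haveI : Nontrivial I.H := C.nontrivial_of_normalised hirr hL hG₁ hG0
  exact C.isTorsion_of_nontrivial hL hL0 Y hY D

/-- A Néron-normalised generator of a NON-ZERO colour is non-zero as soon as `ϖ ≠ 0`
(`ι : Λ → ℚ_p⟦T⟧` is injective and `ℚ_p⟦T⟧` is a domain); private plumbing. [folklore] -/
private theorem normalised_ne_zero {ϖ' : ℚ} (hϖ : ϖ' ≠ 0) {Lsharp Lflat G₁ : IwasawaAlgebra p}
    (hL0 : chromaticL col Lsharp Lflat ≠ 0)
    (hG₁ : iwasawaToPowerSeries p G₁ =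
      PowerSeries.C ((ϖ' : ℚ) : ℚ_[p]) * iwasawaToPowerSeries p (chromaticL col Lsharp Lflat)) :
    G₁ ≠ 0 := by
  rintro rfl
  rw [map_zero, eq_comm, mul_eq_zero] at hG₁
  rcases hG₁ with h | h
  · have h' := congrArg PowerSeries.constantCoeff h
    simp only [PowerSeries.constantCoeff_C, map_zero] at h'
    exact hϖ (by exact_mod_cast h')
  · exact hL0 (iwasawaToPowerSeries_injective p (by rw [h, map_zero]))

end Package

/-! ## §2 The named fact Thm. 7.14 from the three named inputs -/

/-- **Sprung 2012 Thm. 1.2 / 7.14 DERIVED**: the named fact `thm714_sharpFlatSelmerDual_finite_torsion`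
(`X^•(E/ℚ_∞)` finitely generated `Λ`-torsion for every odd good supersingular `p`, every newform `f` of
`E`, the cyclotomic pair `(κ, γ)` matching the cyclotomic variable, the place `v ∣ p` with local lift `g`
and Honda system `(cneg, c)`, every colour `•` and Sprung pair with `L^• ≠ 0`, every dual datum) follows
from: `hCK` — the ♯/♭ Coleman–Kato package `thm714seq_sharpFlatColemanKato_zeta` (Def. 6.1, Props.
7.3/7.6, (3) of Thm. 7.14 with Kato's Thm. 12.6 zeta submodule, on pinned objects); `hH1` — Kato's
(12.2.2) `1 ≤ rank_Λ 𝐇¹_Γ(T_pW)` (`Kato2004.one_le_rank_iwasawaH1`); `hYt` — Kato's Thm. 12.4 (1) ∘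
(17.13.1), `X₀(E/ℚ_∞)` torsion (`Kato2004_fineSelmerDual_isTorsion`). Proof: finite generation is the
tree theorem `SharpFlatSelmerDualData.moduleFinite`; for torsion take the period ratio `ϖ` of `f`
(`ModularParametrizationData.exists_rat_mul_realPeriodRat_eq_plusPeriod` on
`nonempty_modularParametrizationData_of_isNewformOf`), the pinned `𝐇¹_Γ` (`nonempty_iwasawaH1Data_holds`,
non-trivial by `hH1`), the package datum (`hCK`) and a fine dual datum (`nonempty_fineSelmerDualData`,
torsion by `hYt`), and apply §1. An implication between named facts; none of the three inputs is
discharged here. [cite: Sprung2012, Thm. 1.2 (p. 1486), Thm. 7.14 with (3) (p. 1504), Def. 6.1 (p. 1495)] -/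
theorem thm714_sharpFlatSelmerDual_finite_torsion_of_colemanKato
    (hCK : thm714seq_sharpFlatColemanKato_zeta) (hH1 : Kato2004.one_le_rank_iwasawaH1)
    (hYt : Kato2004_fineSelmerDual_isTorsion) :
    thm714_sharpFlatSelmerDual_finite_torsion := by
  intro W _ _ p _ hp hgood hss N _ f hf κ γ hκ hγ hγ' v hv g hg cneg c hH col Lsharp Lflat hL hL0 D
  refine ⟨D.moduleFinite hγ, ?_⟩
  -- the period ratio of the newform `f`
  obtain ⟨Dm⟩ := Literature.NumberTheory.Automorphic.nonempty_modularParametrizationData_of_isNewformOf hf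
  obtain ⟨ϖ, -, hϖ, -⟩ := Dm.exists_rat_mul_realPeriodRat_eq_plusPeriod
  rw [Dm.isNewformOf.unique hf] at hϖ
  -- pins: `T_pW` structure facts, `𝐇¹_Γ` (non-trivial by (12.2.2)), the package datum, `X₀`
  haveI : ContinuousSMul ℤ_[p] (W.tateModule p) := TateModule.continuousSMul_padicInt
  haveI : Module.Free ℤ_[p] (W.tateModule p) := W.module_free_tateModule_holds p
  haveI : Module.Finite ℤ_[p] (W.tateModule p) := W.module_finite_tateModule_holds p
  obtain ⟨I⟩ := Kato2004.nonempty_iwasawaH1Data_holds W p κ γ hκ hγ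
  haveI : Nontrivial I.H := Kato2004.nontrivial_of_one_le_rank_iwasawaH1 hH1 W p κ γ hκ hγ I
  obtain ⟨C⟩ := hCK W p f ϖ κ γ hp hgood hss hf hϖ hκ hγ hγ' v hv g hg cneg c hH col I
  obtain ⟨Y⟩ := W.nonempty_fineSelmerDualData κ hγ
  exact C.isTorsion_of_nontrivial hL hL0 Y (hYt W p κ γ hκ hγ Y) D

/-! ## §3 The same from the joint (two-colour) package -/

/-- **Thm. 7.14 from the JOINT package** `thm714seq_sharpFlatColemanKato_zetaJoint` (the two-colour
reading with a shared zeta submodule; hypothesis `hJ` of the crux line `chromatic-common-zeros`) + Kato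
(12.2.2) + Kato Thm. 12.4 (1): by `thm714seq_sharpFlatColemanKato_zeta_of_joint` and §2.
[cite: Sprung2012, Def. 7.12 (p. 1503), Thm. 7.14 with (3) (p. 1504), Prop. 7.19 (p. 1505)] -/
theorem thm714_sharpFlatSelmerDual_finite_torsion_of_zetaJoint
    (hJ : thm714seq_sharpFlatColemanKato_zetaJoint) (hH1 : Kato2004.one_le_rank_iwasawaH1)
    (hYt : Kato2004_fineSelmerDual_isTorsion) :
    thm714_sharpFlatSelmerDual_finite_torsion :=
  thm714_sharpFlatSelmerDual_finite_torsion_of_colemanKato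
    (thm714seq_sharpFlatColemanKato_zeta_of_joint hJ) hH1 hYt

/-! ## §4 The torsion clause WITHOUT (12.2.2) at irreducible image (the class-X8 shape) -/

/-- **Thm. 7.14 for ONE curve at irreducible image, from the package and Kato's Thm. 12.4 (1) alone**:
in the binder telescope of the fact, if moreover `ρ̄_{E,p}` is irreducible and the colour `•` (with
`L^• ≠ 0`) admits a Néron-normalised generator `G₁` for a period ratio `ϖ ≠ 0` of `f`
(`ι G₁ = C(ϖ)·ι L^•`; e.g. `|ϖ|_p = 1`), then every dual datum of `Sel^•(E/ℚ_∞)` is finitely generated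
`Λ`-torsion — `𝐇¹ ≠ 0` now coming from `Z ≠ 0` (§1 `nontrivial_of_normalised`) instead of (12.2.2).
[cite: Sprung2012, Thm. 1.2 (p. 1486), Def. 6.1 (p. 1495), Thm. 7.14 with (3) (p. 1504)] -/
theorem sharpFlatSelmerDual_finite_torsion_of_colemanKato_of_irreducible
    (hCK : thm714seq_sharpFlatColemanKato_zeta) (hYt : Kato2004_fineSelmerDual_isTorsion)
    (W : WeierstrassCurve ℚ) [W.IsElliptic] [W.IsGloballyMinimal] (p : ℕ) [Fact p.Prime]
    (hp : p ≠ 2) (hgood : W.HasGoodReductionAtPrime p) (hss : (p : ℤ) ∣ W.frobeniusTrace p)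
    (hirr : W.HasIrreducibleModPGaloisRep p)
    {N : ℕ} [NeZero N] (f : CuspForm (Gamma0 N) 2) (hf : IsNewformOf W f) (ϖ : ℚ) (hϖ0 : ϖ ≠ 0)
    (hϖ : (ϖ : ℝ) * W.realPeriodRat = plusPeriod f)
    (κ : ZpExtension ℚ p) (γ : absoluteGaloisGroup ℚ)
    (hκ : κ.IsCyclotomic) (hγ : κ.IsTopGenerator γ) (hγ' : IsCyclotomicVariable p γ)
    (v : HeightOneSpectrum (𝓞 ℚ)) (hv : (p : 𝓞 ℚ) ∈ v.asIdeal)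
    (g : absoluteGaloisGroup (v.adicCompletion ℚ))
    (hg : κ.IsTopGenerator (resGalOfEmb (closureEmb (K := ℚ) (v.adicCompletion ℚ)) g))
    (cneg : localPoints W (v.adicCompletion ℚ)) (c : ℕ → localPoints W (v.adicCompletion ℚ))
    (hH : IsHondaSystem κ (closureEmb (K := ℚ) (v.adicCompletion ℚ)) W (W.frobeniusTrace p) g cneg c)
    (col : Chroma) (Lsharp Lflat : IwasawaAlgebra p)
    (hL : IsSprungPair f p (W.frobeniusTrace p) Lsharp Lflat) (hL0 : chromaticL col Lsharp Lflat ≠ 0)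
    (G₁ : IwasawaAlgebra p)
    (hG₁ : iwasawaToPowerSeries p G₁ =
      PowerSeries.C ((ϖ : ℚ) : ℚ_[p]) * iwasawaToPowerSeries p (chromaticL col Lsharp Lflat))
    (D : SharpFlatSelmerDualData W κ γ (closureEmb (K := ℚ) (v.adicCompletion ℚ))
      (W.frobeniusTrace p) g c col) :
    Module.Finite (IwasawaAlgebra p) D.X ∧ Module.IsTorsion (IwasawaAlgebra p) D.X := by
  refine ⟨D.moduleFinite hγ, ?_⟩
  haveI : ContinuousSMul ℤ_[p] (W.tateModule p) := TateModule.continuousSMul_padicInt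
  haveI : Module.Free ℤ_[p] (W.tateModule p) := W.module_free_tateModule_holds p
  haveI : Module.Finite ℤ_[p] (W.tateModule p) := W.module_finite_tateModule_holds p
  obtain ⟨I⟩ := Kato2004.nonempty_iwasawaH1Data_holds W p κ γ hκ hγ
  obtain ⟨C⟩ := hCK W p f ϖ κ γ hp hgood hss hf hϖ hκ hγ hγ' v hv g hg cneg c hH col I
  obtain ⟨Y⟩ := W.nonempty_fineSelmerDualData κ hγ
  exact C.isTorsion_of_normalised hirr hL hL0 hG₁ (normalised_ne_zero hϖ0 hL0 hG₁) Y
    (hYt W p κ γ hκ hγ Y) D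

end Literature.NumberTheory.EllipticCurves.Sprung2012

end
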